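import Summits.CriticalPhenomena.SAWScalingLimit.Theorems.SAWRenewalTightnessEventualTightAnyShape
import Summits.CriticalPhenomena.SAWScalingLimit.Theorems.SAWRenewalTightnessEventualTightShapeReduction
import Summits.CriticalPhenomena.SAWScalingLimit.Theorems.SAWRenewalTightnessEventualTightSplit

/-!
# `EventualTight`, line `Sketch` v12: the bulk atom at ANY shape closes the bulk leaf and (with E) the crux — glue

Crux stmt-CriticalPhenomena-1372 (`SAWRenewalTightness.EventualTight`; bulk child `BulkShellTight`, stmt-17588; bulk atom
`VirginArcTraversalTightBounded`, stmt-18042), line `Sketch`, registration v12 (lead c11).  Compositions over the shape-generic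
rungs of `…EventualTightAnyShape.lean` (rung B and V4 at the lattice shell `D(z₀; ρ₁N, ρ₂N)`) and the arbitrary-aspect reduction of
`…EventualTightShapeReduction.lean`:

* `bulkShellTight_of_virginArcTraversalTightBoundedShape` — for `0 < ρ₁ < ρ₂ < 1`, the bounded-finite-exterior virgin-arc
  traversal bound at the shell `D(z₀; ρ₁N, ρ₂N)` implies the route decl `BulkShellTight` (stmt-17588) by name;
* `eventualTight_of_virginArcTraversalTightBoundedShape_of_confinementPositivity` — and with `ConfinementPositivity`
  (stmt-17587) the crux `EventualTight` by name (`EventualTight_of_subs`);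
* `virginArcTraversalTightBoundedShape_mono` — thin ⇒ fat: the atom at `(ρ₁, ρ₂)` implies it at every `(ρ₁', ρ₂')` with
  `ρ₁' ≤ ρ₁`, `ρ₂ ≤ ρ₂'`, so the thick shells (`ρ₁ → 0`, `ρ₂ → 1`) are the weakest sufficient forms of item stmt-18042;
* `virginArcTraversalTightBoundedShape_of_registered` — the registered atom X2c₁ᵇ (radii written `2 * N / 5`, `3 * N / 5`) is
  the shape `(2/5, 3/5)`, and `bulkShellTight_of_registered_viaShape` re-derives the landed
  `bulkShellTight_of_virginArcTraversalTightBounded` (p151500) through the generic route (specialisation check).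

[cite: DuminilCopinSmirnov2012, §2 (domain Markov property)] [cite: AizenmanBurchardDuke1999, §1.b and §3.a]
-/

noncomputable section

open MeasureTheory Filter Topology Set Metric
open scoped ENNReal NNReal unitInterval
open Literature.Probability.RandomPlanarGeometry Literature.Probability.LatticeModels

namespace Summit.CriticalPhenomena.SAWScalingLimit.Theorems

/-- **The bulk leaf from the atom at any shape.**  For `0 < ρ₁ < ρ₂ < 1`, the bounded-finite-exterior virgin-arc traversal
bound at the lattice shell `D(z₀; ρ₁N, ρ₂N)` implies the route decl `BulkShellTight` (stmt-CriticalPhenomena-17588): rung B and V4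
at shape `(ρ₁, ρ₂)` (this file) give tightness on the domain shells of aspect `2ρ₂/ρ₁` with collar `2/ρ₁`, and the arbitrary-aspect
reduction `bulkShellTight_of_bulkShellTightAtAspect` does the rest (`1 < 2ρ₂/ρ₁` from `ρ₁ < ρ₂`, `0 < 2/ρ₁`).
[cite: AizenmanBurchardDuke1999, §1.b and §3.a] -/
theorem bulkShellTight_of_virginArcTraversalTightBoundedShape (ρ₁ ρ₂ : ℝ) (hρ₁ : 0 < ρ₁) (hρ₁₂ : ρ₁ < ρ₂) (hρ₂ : ρ₂ < 1)
    (hX : ∀ C θ : ℝ, 0 < θ →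
      ∃ (k : ℕ) (N₀ : ℝ), 0 < N₀ ∧
        ∀ (H : SimpleGraph (Site 2)) (Λ : Set (Site 2)) (z₀ : ℂ) (N : ℝ) (u c u' c' : Site 2),
          Λ.Finite → (∀ v ∈ Λ, dist (Site.toComplex v) z₀ ≤ C * N) → N₀ ≤ N →
          (H ≤ zdGraph 2 ∧ (∀ v : Site 2, dist (Site.toComplex v) z₀ ≤ N → v ∈ Λ) ∧
            ∀ v v' : Site 2, dist (Site.toComplex v) z₀ ≤ N + 1 →
              dist (Site.toComplex v') z₀ ≤ N + 1 → (zdGraph 2).Adj v v' → H.Adj v v') →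
          (H.Adj u c ∧ u ∉ Λ ∧ c ∈ Λ ∧ dist (Site.toComplex c) z₀ ≤ N ∧
            N < dist (Site.toComplex u) z₀) →
          (H.Adj u' c' ∧ u' ∉ Λ ∧ c' ∈ Λ ∧ dist (Site.toComplex c') z₀ ≤ N ∧
            N < dist (Site.toComplex u') z₀) →
          ∑' p : {p : {p : H.Walk c c' // p.IsPath ∧ ∀ v ∈ p.support, v ∈ Λ} //
              ∃ ι κ : Fin k → Fin (p.1.support.map Site.toComplex).length, (∀ m, ι m ≤ κ m) ∧
                (∀ m, (dist ((p.1.support.map Site.toComplex).get (ι m)) z₀ ≤ ρ₁ * N ∧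
                    ρ₂ * N ≤ dist ((p.1.support.map Site.toComplex).get (κ m)) z₀) ∨
                  (ρ₂ * N ≤ dist ((p.1.support.map Site.toComplex).get (ι m)) z₀ ∧
                    dist ((p.1.support.map Site.toComplex).get (κ m)) z₀ ≤ ρ₁ * N)) ∧
                ∀ ⦃m m'⦄, m < m' → κ m ≤ ι m'},
              ENNReal.ofReal (SAW.criticalFugacity ^ p.1.1.length) ≤
            ENNReal.ofReal θ *
              ∑' p : {p : H.Walk c c' // p.IsPath ∧ ∀ v ∈ p.support, v ∈ Λ},
                ENNReal.ofReal (SAW.criticalFugacity ^ p.1.length)) :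
    Summit.CriticalPhenomena.SAWScalingLimit.Theses.SAWRenewalTightness.BulkShellTight := by
  have hA : 1 < 2 * ρ₂ / ρ₁ := by
    rw [lt_div_iff₀ hρ₁]; linarith
  have hK : 0 < 2 / ρ₁ := by positivity
  refine bulkShellTight_of_bulkShellTightAtAspect (2 * ρ₂ / ρ₁) (2 / ρ₁) hA hK ?_
  exact bulkShellTightAtAspect_of_virginArcTraversalTightReachShape ρ₁ ρ₂ hρ₁ hρ₁₂ hρ₂
    (virginArcTraversalTightReachShape_of_boundedShape ρ₁ ρ₂ hX)

/-- **The crux from the atom at any shape and restriction positivity.**  For `0 < ρ₁ < ρ₂ < 1`, the bounded-finite-exterior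
virgin-arc traversal bound at the lattice shell `D(z₀; ρ₁N, ρ₂N)` and `ConfinementPositivity` (stmt-CriticalPhenomena-17587, stated
verbatim as the hypothesis `hE`) imply the crux `EventualTight` by name: `EventualTight_of_subs` (`…EventualTightSplit.lean`)
applied to `hE` and `bulkShellTight_of_virginArcTraversalTightBoundedShape`.
[cite: AizenmanBurchardDuke1999, §1.b and §3.a] [cite: DuminilCopinSmirnov2012, §2 (domain Markov property)] -/
theorem eventualTight_of_virginArcTraversalTightBoundedShape_of_confinementPositivity :
    ∀ ρ₁ ρ₂ : ℝ, 0 < ρ₁ → ρ₁ < ρ₂ → ρ₂ < 1 →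
    (∀ C θ : ℝ, 0 < θ →
      ∃ (k : ℕ) (N₀ : ℝ), 0 < N₀ ∧
        ∀ (H : SimpleGraph (Site 2)) (Λ : Set (Site 2)) (z₀ : ℂ) (N : ℝ) (u c u' c' : Site 2),
          Λ.Finite → (∀ v ∈ Λ, dist (Site.toComplex v) z₀ ≤ C * N) → N₀ ≤ N →
          (H ≤ zdGraph 2 ∧ (∀ v : Site 2, dist (Site.toComplex v) z₀ ≤ N → v ∈ Λ) ∧
            ∀ v v' : Site 2, dist (Site.toComplex v) z₀ ≤ N + 1 →
              dist (Site.toComplex v') z₀ ≤ N + 1 → (zdGraph 2).Adj v v' → H.Adj v v') →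
          (H.Adj u c ∧ u ∉ Λ ∧ c ∈ Λ ∧ dist (Site.toComplex c) z₀ ≤ N ∧
            N < dist (Site.toComplex u) z₀) →
          (H.Adj u' c' ∧ u' ∉ Λ ∧ c' ∈ Λ ∧ dist (Site.toComplex c') z₀ ≤ N ∧
            N < dist (Site.toComplex u') z₀) →
          ∑' p : {p : {p : H.Walk c c' // p.IsPath ∧ ∀ v ∈ p.support, v ∈ Λ} //
              ∃ ι κ : Fin k → Fin (p.1.support.map Site.toComplex).length, (∀ m, ι m ≤ κ m) ∧
                (∀ m, (dist ((p.1.support.map Site.toComplex).get (ι m)) z₀ ≤ ρ₁ * N ∧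
                    ρ₂ * N ≤ dist ((p.1.support.map Site.toComplex).get (κ m)) z₀) ∨
                  (ρ₂ * N ≤ dist ((p.1.support.map Site.toComplex).get (ι m)) z₀ ∧
                    dist ((p.1.support.map Site.toComplex).get (κ m)) z₀ ≤ ρ₁ * N)) ∧
                ∀ ⦃m m'⦄, m < m' → κ m ≤ ι m'},
              ENNReal.ofReal (SAW.criticalFugacity ^ p.1.1.length) ≤
            ENNReal.ofReal θ *
              ∑' p : {p : H.Walk c c' // p.IsPath ∧ ∀ v ∈ p.support, v ∈ Λ},
                ENNReal.ofReal (SAW.criticalFugacity ^ p.1.length)) →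
    (∀ (D D' : DobrushinDomain) (a b : ℝ → Site 2) (d : ℝ), 0 < d →
      D'.carrier ⊆ D.carrier → D'.pt 0 = D.pt 0 → D'.pt 1 = D.pt 1 →
      D.carrier ∩ (Metric.ball (D.pt 0) d ∪ Metric.ball (D.pt 1) d) ⊆ D'.carrier →
      SAW.IsEndpointApprox D' a b →
        ∃ c δ₀ : ℝ, 0 < c ∧ 0 < δ₀ ∧ ∀ δ ∈ Set.Ioc (0 : ℝ) δ₀,
          ENNReal.ofReal c ≤ SAW.law D.carrier δ (a δ) (b δ)
            {γ | ∃ γ' : SAW.DomainSAW D'.carrier δ (a δ) (b δ), γ'.walk.support = γ.walk.support}) →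
    Summit.CriticalPhenomena.SAWScalingLimit.Theses.SAWRenewalTightness.EventualTight := by
  intro ρ₁ ρ₂ hρ₁ hρ₁₂ hρ₂ hX hE
  have hB := bulkShellTight_of_virginArcTraversalTightBoundedShape ρ₁ ρ₂ hρ₁ hρ₁₂ hρ₂ hX
  unfold Summit.CriticalPhenomena.SAWScalingLimit.Theses.SAWRenewalTightness.BulkShellTight at hB
  exact EventualTight_of_subs hE hB

/-- **Thin ⇒ fat for weak vertex traversals of a list**: `k` weak vertex traversals of the shell with radii `(n, R)` are `k`
weak vertex traversals of any shell with radii `(n', R')`, `n ≤ n'`, `R' ≤ R` (same index maps). [folklore] -/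
theorem hasVertexTraversals_mono {l : List ℂ} {k : ℕ} {z₀ : ℂ} {n R n' R' : ℝ} (hn : n ≤ n') (hR : R' ≤ R)
    (h : ∃ ι κ : Fin k → Fin l.length, (∀ m, ι m ≤ κ m) ∧
      (∀ m, (dist (l.get (ι m)) z₀ ≤ n ∧ R ≤ dist (l.get (κ m)) z₀) ∨
        (R ≤ dist (l.get (ι m)) z₀ ∧ dist (l.get (κ m)) z₀ ≤ n)) ∧
      ∀ ⦃m m'⦄, m < m' → κ m ≤ ι m') :
    ∃ ι κ : Fin k → Fin l.length, (∀ m, ι m ≤ κ m) ∧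
      (∀ m, (dist (l.get (ι m)) z₀ ≤ n' ∧ R' ≤ dist (l.get (κ m)) z₀) ∨
        (R' ≤ dist (l.get (ι m)) z₀ ∧ dist (l.get (κ m)) z₀ ≤ n')) ∧
      ∀ ⦃m m'⦄, m < m' → κ m ≤ ι m' := by
  obtain ⟨ι, κ, hικ, hside, hord⟩ := h
  refine ⟨ι, κ, hικ, fun m => ?_, hord⟩
  rcases hside m with ⟨h1, h2⟩ | ⟨h1, h2⟩
  · exact Or.inl ⟨h1.trans hn, hR.trans h2⟩
  · exact Or.inr ⟨hR.trans h1, h2.trans hn⟩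

/-- **Thin ⇒ fat for the atom**: the bounded-finite-exterior virgin-arc traversal bound at the shell `D(z₀; ρ₁N, ρ₂N)` implies it
at every thicker shell `D(z₀; p'N, q'N)`, `ρ₁' ≤ ρ₁`, `ρ₂ ≤ ρ₂'` (same `k`, `N₀`; the traversal sub-sum only shrinks,
`tsum_subtype_subtype_mono_of_imp` with `hasVertexTraversals_mono`).  So the thick shells are the weakest sufficient forms of the
atom. [folklore] -/
theorem virginArcTraversalTightBoundedShape_mono (ρ₁ ρ₂ ρ₁' ρ₂' : ℝ) (hρ₁' : ρ₁' ≤ ρ₁) (hρ₂' : ρ₂ ≤ ρ₂')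
    (hX : ∀ C θ : ℝ, 0 < θ →
      ∃ (k : ℕ) (N₀ : ℝ), 0 < N₀ ∧
        ∀ (H : SimpleGraph (Site 2)) (Λ : Set (Site 2)) (z₀ : ℂ) (N : ℝ) (u c u' c' : Site 2),
          Λ.Finite → (∀ v ∈ Λ, dist (Site.toComplex v) z₀ ≤ C * N) → N₀ ≤ N →
          (H ≤ zdGraph 2 ∧ (∀ v : Site 2, dist (Site.toComplex v) z₀ ≤ N → v ∈ Λ) ∧
            ∀ v v' : Site 2, dist (Site.toComplex v) z₀ ≤ N + 1 →
              dist (Site.toComplex v') z₀ ≤ N + 1 → (zdGraph 2).Adj v v' → H.Adj v v') →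
          (H.Adj u c ∧ u ∉ Λ ∧ c ∈ Λ ∧ dist (Site.toComplex c) z₀ ≤ N ∧
            N < dist (Site.toComplex u) z₀) →
          (H.Adj u' c' ∧ u' ∉ Λ ∧ c' ∈ Λ ∧ dist (Site.toComplex c') z₀ ≤ N ∧
            N < dist (Site.toComplex u') z₀) →
          ∑' p : {p : {p : H.Walk c c' // p.IsPath ∧ ∀ v ∈ p.support, v ∈ Λ} //
              ∃ ι κ : Fin k → Fin (p.1.support.map Site.toComplex).length, (∀ m, ι m ≤ κ m) ∧
                (∀ m, (dist ((p.1.support.map Site.toComplex).get (ι m)) z₀ ≤ ρ₁ * N ∧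
                    ρ₂ * N ≤ dist ((p.1.support.map Site.toComplex).get (κ m)) z₀) ∨
                  (ρ₂ * N ≤ dist ((p.1.support.map Site.toComplex).get (ι m)) z₀ ∧
                    dist ((p.1.support.map Site.toComplex).get (κ m)) z₀ ≤ ρ₁ * N)) ∧
                ∀ ⦃m m'⦄, m < m' → κ m ≤ ι m'},
              ENNReal.ofReal (SAW.criticalFugacity ^ p.1.1.length) ≤
            ENNReal.ofReal θ *
              ∑' p : {p : H.Walk c c' // p.IsPath ∧ ∀ v ∈ p.support, v ∈ Λ},
                ENNReal.ofReal (SAW.criticalFugacity ^ p.1.length)) :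
    ∀ C θ : ℝ, 0 < θ →
      ∃ (k : ℕ) (N₀ : ℝ), 0 < N₀ ∧
        ∀ (H : SimpleGraph (Site 2)) (Λ : Set (Site 2)) (z₀ : ℂ) (N : ℝ) (u c u' c' : Site 2),
          Λ.Finite → (∀ v ∈ Λ, dist (Site.toComplex v) z₀ ≤ C * N) → N₀ ≤ N →
          (H ≤ zdGraph 2 ∧ (∀ v : Site 2, dist (Site.toComplex v) z₀ ≤ N → v ∈ Λ) ∧
            ∀ v v' : Site 2, dist (Site.toComplex v) z₀ ≤ N + 1 →
              dist (Site.toComplex v') z₀ ≤ N + 1 → (zdGraph 2).Adj v v' → H.Adj v v') →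
          (H.Adj u c ∧ u ∉ Λ ∧ c ∈ Λ ∧ dist (Site.toComplex c) z₀ ≤ N ∧
            N < dist (Site.toComplex u) z₀) →
          (H.Adj u' c' ∧ u' ∉ Λ ∧ c' ∈ Λ ∧ dist (Site.toComplex c') z₀ ≤ N ∧
            N < dist (Site.toComplex u') z₀) →
          ∑' p : {p : {p : H.Walk c c' // p.IsPath ∧ ∀ v ∈ p.support, v ∈ Λ} //
              ∃ ι κ : Fin k → Fin (p.1.support.map Site.toComplex).length, (∀ m, ι m ≤ κ m) ∧
                (∀ m, (dist ((p.1.support.map Site.toComplex).get (ι m)) z₀ ≤ ρ₁' * N ∧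
                    ρ₂' * N ≤ dist ((p.1.support.map Site.toComplex).get (κ m)) z₀) ∨
                  (ρ₂' * N ≤ dist ((p.1.support.map Site.toComplex).get (ι m)) z₀ ∧
                    dist ((p.1.support.map Site.toComplex).get (κ m)) z₀ ≤ ρ₁' * N)) ∧
                ∀ ⦃m m'⦄, m < m' → κ m ≤ ι m'},
              ENNReal.ofReal (SAW.criticalFugacity ^ p.1.1.length) ≤
            ENNReal.ofReal θ *
              ∑' p : {p : H.Walk c c' // p.IsPath ∧ ∀ v ∈ p.support, v ∈ Λ},
                ENNReal.ofReal (SAW.criticalFugacity ^ p.1.length) := by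
  intro C θ hθ
  obtain ⟨k, N₀, hN₀, hk⟩ := hX C θ hθ
  refine ⟨k, N₀, hN₀, fun H Λ z₀ N u c u' c' hfin hbd hN hV hD hD' => le_trans ?_
    (hk H Λ z₀ N u c u' c' hfin hbd hN hV hD hD')⟩
  have hNnn : 0 ≤ N := hN₀.le.trans hN
  exact tsum_subtype_mono_of_imp
    (fun w : {w : H.Walk c c' // w.IsPath ∧ ∀ v ∈ w.support, v ∈ Λ} =>
      ENNReal.ofReal (SAW.criticalFugacity ^ w.1.length))
    (fun w hw => hasVertexTraversals_mono (mul_le_mul_of_nonneg_right hρ₁' hNnn)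
      (mul_le_mul_of_nonneg_right hρ₂' hNnn) hw)

/-- **The registered atom is the shape `(2/5, 3/5)`**: X2c₁ᵇ (`stub_virginArcTraversalTightBounded`, item
stmt-CriticalPhenomena-18042, radii written `2 * N / 5`, `3 * N / 5`) gives the shape-`(2/5, 3/5)` atom of this file (radii
`2 / 5 * N`, `3 / 5 * N`); the two differ only in the bracketing of the radii. [folklore] -/
theorem virginArcTraversalTightBoundedShape_of_registered
    (hX : ∀ C θ : ℝ, 0 < θ →
      ∃ (k : ℕ) (N₀ : ℝ), 0 < N₀ ∧
        ∀ (H : SimpleGraph (Site 2)) (Λ : Set (Site 2)) (z₀ : ℂ) (N : ℝ) (u c u' c' : Site 2),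
          Λ.Finite → (∀ v ∈ Λ, dist (Site.toComplex v) z₀ ≤ C * N) → N₀ ≤ N →
          (H ≤ zdGraph 2 ∧ (∀ v : Site 2, dist (Site.toComplex v) z₀ ≤ N → v ∈ Λ) ∧
            ∀ v v' : Site 2, dist (Site.toComplex v) z₀ ≤ N + 1 →
              dist (Site.toComplex v') z₀ ≤ N + 1 → (zdGraph 2).Adj v v' → H.Adj v v') →
          (H.Adj u c ∧ u ∉ Λ ∧ c ∈ Λ ∧ dist (Site.toComplex c) z₀ ≤ N ∧
            N < dist (Site.toComplex u) z₀) →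
          (H.Adj u' c' ∧ u' ∉ Λ ∧ c' ∈ Λ ∧ dist (Site.toComplex c') z₀ ≤ N ∧
            N < dist (Site.toComplex u') z₀) →
          ∑' p : {p : {p : H.Walk c c' // p.IsPath ∧ ∀ v ∈ p.support, v ∈ Λ} //
              ∃ ι κ : Fin k → Fin (p.1.support.map Site.toComplex).length, (∀ m, ι m ≤ κ m) ∧
                (∀ m, (dist ((p.1.support.map Site.toComplex).get (ι m)) z₀ ≤ 2 * N / 5 ∧
                    3 * N / 5 ≤ dist ((p.1.support.map Site.toComplex).get (κ m)) z₀) ∨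
                  (3 * N / 5 ≤ dist ((p.1.support.map Site.toComplex).get (ι m)) z₀ ∧
                    dist ((p.1.support.map Site.toComplex).get (κ m)) z₀ ≤ 2 * N / 5)) ∧
                ∀ ⦃m m'⦄, m < m' → κ m ≤ ι m'},
              ENNReal.ofReal (SAW.criticalFugacity ^ p.1.1.length) ≤
            ENNReal.ofReal θ *
              ∑' p : {p : H.Walk c c' // p.IsPath ∧ ∀ v ∈ p.support, v ∈ Λ},
                ENNReal.ofReal (SAW.criticalFugacity ^ p.1.length)) :
    ∀ C θ : ℝ, 0 < θ →
      ∃ (k : ℕ) (N₀ : ℝ), 0 < N₀ ∧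
        ∀ (H : SimpleGraph (Site 2)) (Λ : Set (Site 2)) (z₀ : ℂ) (N : ℝ) (u c u' c' : Site 2),
          Λ.Finite → (∀ v ∈ Λ, dist (Site.toComplex v) z₀ ≤ C * N) → N₀ ≤ N →
          (H ≤ zdGraph 2 ∧ (∀ v : Site 2, dist (Site.toComplex v) z₀ ≤ N → v ∈ Λ) ∧
            ∀ v v' : Site 2, dist (Site.toComplex v) z₀ ≤ N + 1 →
              dist (Site.toComplex v') z₀ ≤ N + 1 → (zdGraph 2).Adj v v' → H.Adj v v') →
          (H.Adj u c ∧ u ∉ Λ ∧ c ∈ Λ ∧ dist (Site.toComplex c) z₀ ≤ N ∧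
            N < dist (Site.toComplex u) z₀) →
          (H.Adj u' c' ∧ u' ∉ Λ ∧ c' ∈ Λ ∧ dist (Site.toComplex c') z₀ ≤ N ∧
            N < dist (Site.toComplex u') z₀) →
          ∑' p : {p : {p : H.Walk c c' // p.IsPath ∧ ∀ v ∈ p.support, v ∈ Λ} //
              ∃ ι κ : Fin k → Fin (p.1.support.map Site.toComplex).length, (∀ m, ι m ≤ κ m) ∧
                (∀ m, (dist ((p.1.support.map Site.toComplex).get (ι m)) z₀ ≤ 2 / 5 * N ∧
                    3 / 5 * N ≤ dist ((p.1.support.map Site.toComplex).get (κ m)) z₀) ∨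
                  (3 / 5 * N ≤ dist ((p.1.support.map Site.toComplex).get (ι m)) z₀ ∧
                    dist ((p.1.support.map Site.toComplex).get (κ m)) z₀ ≤ 2 / 5 * N)) ∧
                ∀ ⦃m m'⦄, m < m' → κ m ≤ ι m'},
              ENNReal.ofReal (SAW.criticalFugacity ^ p.1.1.length) ≤
            ENNReal.ofReal θ *
              ∑' p : {p : H.Walk c c' // p.IsPath ∧ ∀ v ∈ p.support, v ∈ Λ},
                ENNReal.ofReal (SAW.criticalFugacity ^ p.1.length) := by
  intro C θ hθ
  obtain ⟨k, N₀, hN₀, hk⟩ := hX C θ hθ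
  refine ⟨k, N₀, hN₀, fun H Λ z₀ N u c u' c' hfin hbd hN hV hD hD' => le_trans ?_
    (hk H Λ z₀ N u c u' c' hfin hbd hN hV hD hD')⟩
  exact tsum_subtype_mono_of_imp
    (fun w : {w : H.Walk c c' // w.IsPath ∧ ∀ v ∈ w.support, v ∈ Λ} =>
      ENNReal.ofReal (SAW.criticalFugacity ^ w.1.length))
    (fun w hw => hasVertexTraversals_mono (n := 2 / 5 * N) (R := 3 / 5 * N) (n' := 2 * N / 5) (R' := 3 * N / 5)
      (le_of_eq (by ring)) (le_of_eq (by ring)) hw)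


/-- **Specialisation check**: the registered atom X2c₁ᵇ (item stmt-CriticalPhenomena-18042 verbatim) implies `BulkShellTight`
through the shape-generic route at `(ρ₁, ρ₂) = (2/5, 3/5)` — the landed `bulkShellTight_of_virginArcTraversalTightBounded`
(`…OfBoundedVirginArc.lean`) re-derived, so the generalisation contains the registered line. [folklore] -/
theorem bulkShellTight_of_registered_viaShape
    (hX : ∀ C θ : ℝ, 0 < θ →
      ∃ (k : ℕ) (N₀ : ℝ), 0 < N₀ ∧
        ∀ (H : SimpleGraph (Site 2)) (Λ : Set (Site 2)) (z₀ : ℂ) (N : ℝ) (u c u' c' : Site 2),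
          Λ.Finite → (∀ v ∈ Λ, dist (Site.toComplex v) z₀ ≤ C * N) → N₀ ≤ N →
          (H ≤ zdGraph 2 ∧ (∀ v : Site 2, dist (Site.toComplex v) z₀ ≤ N → v ∈ Λ) ∧
            ∀ v v' : Site 2, dist (Site.toComplex v) z₀ ≤ N + 1 →
              dist (Site.toComplex v') z₀ ≤ N + 1 → (zdGraph 2).Adj v v' → H.Adj v v') →
          (H.Adj u c ∧ u ∉ Λ ∧ c ∈ Λ ∧ dist (Site.toComplex c) z₀ ≤ N ∧
            N < dist (Site.toComplex u) z₀) →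
          (H.Adj u' c' ∧ u' ∉ Λ ∧ c' ∈ Λ ∧ dist (Site.toComplex c') z₀ ≤ N ∧
            N < dist (Site.toComplex u') z₀) →
          ∑' p : {p : {p : H.Walk c c' // p.IsPath ∧ ∀ v ∈ p.support, v ∈ Λ} //
              ∃ ι κ : Fin k → Fin (p.1.support.map Site.toComplex).length, (∀ m, ι m ≤ κ m) ∧
                (∀ m, (dist ((p.1.support.map Site.toComplex).get (ι m)) z₀ ≤ 2 * N / 5 ∧
                    3 * N / 5 ≤ dist ((p.1.support.map Site.toComplex).get (κ m)) z₀) ∨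
                  (3 * N / 5 ≤ dist ((p.1.support.map Site.toComplex).get (ι m)) z₀ ∧
                    dist ((p.1.support.map Site.toComplex).get (κ m)) z₀ ≤ 2 * N / 5)) ∧
                ∀ ⦃m m'⦄, m < m' → κ m ≤ ι m'},
              ENNReal.ofReal (SAW.criticalFugacity ^ p.1.1.length) ≤
            ENNReal.ofReal θ *
              ∑' p : {p : H.Walk c c' // p.IsPath ∧ ∀ v ∈ p.support, v ∈ Λ},
                ENNReal.ofReal (SAW.criticalFugacity ^ p.1.length)) :
    Summit.CriticalPhenomena.SAWScalingLimit.Theses.SAWRenewalTightness.BulkShellTight :=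
  bulkShellTight_of_virginArcTraversalTightBoundedShape (2 / 5) (3 / 5) (by norm_num) (by norm_num) (by norm_num)
    (virginArcTraversalTightBoundedShape_of_registered hX)

end Summit.CriticalPhenomena.SAWScalingLimit.Theorems

end
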